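import Summits.PneNP.PneNP.Theses.Mobius
import Summits.QuantumAdvantage.QuantumAdvantage.Theorems.MobiusLadderLiouvilleNotPPolyStrength

/-!
# Route Mobius — `LiouvilleInNP` (stmt-PneNP-1111)

`bin {N : λ(N) = 1} ∈ NP` (Pratt 1975 / folklore `λ ∈ NP ∩ coNP`): certificate = the prime factorisation with
multiplicity plus Pratt certificates, verifier checks the product, the primality certificates and the PARITY of the
number of primes. This is exactly the kernel-checked theorem `liouvillePos_mem_NP` of the QuantumAdvantage MobiusLadder
helper file (same statement, same classes), which we import and reuse rather than re-prove.
-/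

set_option linter.dupNamespace false -- `Summit.PneNP.PneNP.…`: summit = sub-problem name (D-0017 single-conjunct layout)

namespace Summit.PneNP.PneNP.Theorems

/-- **Support item `LiouvilleInNP` of route Mobius (stmt-PneNP-1111)**: `bin {N : λ(N) = 1} ∈ NP`, by the landed
Pratt-certificate verifier `Summit.QuantumAdvantage.QuantumAdvantage.Theorems.LiouvilleNotPPoly.liouvillePos_mem_NP`.
[cite: Pratt1975, Thm. 1] [cite: AroraBarak2009, Example 2.3] -/
theorem mobius_liouvilleInNP_proof : Summit.PneNP.PneNP.Theses.Mobius.LiouvilleInNP :=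
  Summit.QuantumAdvantage.QuantumAdvantage.Theorems.LiouvilleNotPPoly.liouvillePos_mem_NP

end Summit.PneNP.PneNP.Theorems
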